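import Mathlib
import HarnessLib
import Summits.HubbardSuperconductivity.HubbardSuperconductivity.Theorems.KLProgrammeKLRegimeSplitPredicatesV3

/-!
# Route `KLProgramme` — crux K3 ENGINE (stmt-HubbardSuperconductivity-20437 `KLRegimeEngineV17F2`), stub (b) v2, numerics side
# (cell gate-hubbard-kl, seat p4 g22): THE COUPLING DOORS — where the couplings `λ_j = Bf·ε_j`, `ε_j = Klam·(|U| + U²j)`, sit under the numerics' doors

The glue of the numerics packages onto the tower assemblies (levels `…LevAssemblyKlEngNumS`, weighted W14♯3) reads every kit row at a coupling `λ_j = Bf·ε_j`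
(`d ≤ j ≤ n`, blocks `d·k ≤ n`), block 0 at `λ_d` or at `λ_1 ≤ λ_j ≤ λ_{d−1}`; the packages hold for `λ ≤ uf`.  **`levNum_couplings`**: from `0 < U`,
`U ≤ uf/(2Bf·Klam + 1)`, `U ≤ 1/(d+1)`, the KL regime `IsKLRegime U cc (−n′)` and the door `cc ≤ uf·log 4/(2Bf·Klam + 1)`:
`0 ≤ λ_i`; `λ_i ≤ uf` (`i ≤ n′`); `λ_d ≤ uf`; `Bf·Klam·U ≤ λ_j`; `λ_j ≤ (d+1)·λ_1` (`j ≤ d`); `0 < λ_1`.  Pure real arithmetic (the coupling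
bookkeeping of `kernelNormsLevels_all_klEng_numS`, factored); nothing about the model is asserted.
References: BGM 2006 §2.8 (2.93)–(2.98) [cite: BenfattoGiulianiMastropietro2006].
-/

noncomputable section

namespace Summit.HubbardSuperconductivity.HubbardSuperconductivity.Theorems.EngineV8

set_option linter.dupNamespace false -- summit = problem name (single-conjunct summit), D-0017

open Real
open Summit.HubbardSuperconductivity.HubbardSuperconductivity.Theorems.KLRegimeSplit
open Summit.HubbardSuperconductivity.HubbardSuperconductivity.Theorems.DispersionFlow

/-- **The coupling doors** (see the module docstring). [cite: BenfattoGiulianiMastropietro2006, §2.8 (2.93)-(2.98)] -/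
theorem levNum_couplings {P : SplitConsts} (hK1 : 1 ≤ P.Klam) {U uf Bf cc : ℝ} {n' d : ℕ} (hU : 0 < U) (hBf1 : 1 ≤ Bf) (huf0 : 0 < uf)
    (hUuf : U ≤ uf / (2 * Bf * P.Klam + 1)) (hUd : U ≤ 1 / ((d : ℝ) + 1)) (hreg' : IsKLRegime U cc (-(n' : ℤ)))
    (hccuf : cc ≤ uf * Real.log 4 / (2 * Bf * P.Klam + 1)) :
    (∀ i, 0 ≤ Bf * epsCoupling P U i) ∧ (∀ i, i ≤ n' → Bf * epsCoupling P U i ≤ uf) ∧ Bf * epsCoupling P U d ≤ uf ∧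
    (∀ j, Bf * P.Klam * U ≤ Bf * epsCoupling P U j) ∧ (∀ j, j ≤ d → Bf * epsCoupling P U j ≤ ((d : ℝ) + 1) * (Bf * epsCoupling P U 1)) ∧
    0 < Bf * epsCoupling P U 1 := by
  have hK0 : 0 < P.Klam := lt_of_lt_of_le one_pos hK1
  have hBf0 : 0 < Bf := lt_of_lt_of_le one_pos hBf1
  have hden : 0 < 2 * Bf * P.Klam + 1 := by positivity
  have hlog : 0 < Real.log 4 := Real.log_pos (by norm_num)
  have hε0 : ∀ i, 0 ≤ epsCoupling P U i := fun i => by unfold epsCoupling; positivity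
  have hl0 : ∀ i, 0 ≤ Bf * epsCoupling P U i := fun i => mul_nonneg hBf0.le (hε0 i)
  have hreg'' : U ^ 2 * (n' : ℝ) * Real.log 4 ≤ cc := by
    have h := hreg'
    simp only [IsKLRegime, Int.cast_neg, Int.cast_natCast, abs_neg, Nat.abs_cast] at h
    exact h
  have hlam : ∀ i, i ≤ n' → Bf * epsCoupling P U i ≤ uf := by
    intro i hi
    have hin' : (i : ℝ) ≤ n' := Nat.cast_le.2 hi
    have h1 : U ^ 2 * (i : ℝ) ≤ uf / (2 * Bf * P.Klam + 1) := by
      have h2 : U ^ 2 * (n' : ℝ) ≤ cc / Real.log 4 := by rw [le_div_iff₀ hlog]; exact hreg''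
      have h3 : cc / Real.log 4 ≤ uf / (2 * Bf * P.Klam + 1) := by
        rw [div_le_iff₀ hlog]
        calc cc ≤ uf * Real.log 4 / (2 * Bf * P.Klam + 1) := hccuf
          _ = uf / (2 * Bf * P.Klam + 1) * Real.log 4 := by ring
      calc U ^ 2 * (i : ℝ) ≤ U ^ 2 * (n' : ℝ) := by gcongr
        _ ≤ uf / (2 * Bf * P.Klam + 1) := h2.trans h3
    unfold epsCoupling
    rw [abs_of_pos hU]
    calc Bf * (P.Klam * (U + U ^ 2 * (i : ℝ))) ≤ Bf * (P.Klam * (uf / (2 * Bf * P.Klam + 1) + uf / (2 * Bf * P.Klam + 1))) := by gcongr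
      _ = uf * (2 * Bf * P.Klam / (2 * Bf * P.Klam + 1)) := by field_simp; ring
      _ ≤ uf * 1 := by
          refine mul_le_mul_of_nonneg_left ?_ huf0.le
          rw [div_le_one hden]; linarith
      _ = uf := mul_one _
  have hd1 : (0 : ℝ) < (d : ℝ) + 1 := by positivity
  have hUd' : U * (d : ℝ) ≤ 1 := by
    have h1 : U * (d : ℝ) ≤ 1 / ((d : ℝ) + 1) * ((d : ℝ) + 1) := by
      have : (d : ℝ) ≤ (d : ℝ) + 1 := by linarith
      exact mul_le_mul hUd this (by positivity) (by positivity)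
    rwa [one_div_mul_cancel hd1.ne'] at h1
  have hlamd : Bf * epsCoupling P U d ≤ uf := by
    have h1 : Bf * P.Klam * U ≤ uf / 2 := by
      have h2 : Bf * P.Klam * U ≤ Bf * P.Klam * (uf / (2 * Bf * P.Klam + 1)) := by gcongr
      have h3 : Bf * P.Klam * (uf / (2 * Bf * P.Klam + 1)) ≤ uf / 2 := by
        rw [mul_div_assoc', div_le_div_iff₀ hden (by norm_num)]
        have : 0 ≤ Bf * P.Klam * uf := by positivity
        linarith
      exact h2.trans h3
    have h0 : 0 ≤ Bf * P.Klam * U := by positivity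
    unfold epsCoupling
    rw [abs_of_pos hU]
    calc Bf * (P.Klam * (U + U ^ 2 * (d : ℝ))) = Bf * P.Klam * U + Bf * P.Klam * U * (U * (d : ℝ)) := by ring
      _ ≤ uf / 2 + uf / 2 * 1 := add_le_add h1 (mul_le_mul h1 hUd' (by positivity) (by positivity))
      _ = uf := by ring
  have hlow : ∀ j, Bf * P.Klam * U ≤ Bf * epsCoupling P U j := by
    intro j
    unfold epsCoupling; rw [abs_of_pos hU]
    have h1 : 0 ≤ Bf * (P.Klam * (U ^ 2 * (j : ℝ))) := by positivity
    have h2 : Bf * (P.Klam * (U + U ^ 2 * (j : ℝ))) = Bf * P.Klam * U + Bf * (P.Klam * (U ^ 2 * (j : ℝ))) := by ring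
    linarith
  have hε1 : 0 < epsCoupling P U 1 := by
    unfold epsCoupling
    have : 0 < |U| + U ^ 2 * ((1 : ℕ) : ℝ) := by positivity
    positivity
  have hεle : ∀ j : ℕ, j ≤ d → Bf * epsCoupling P U j ≤ ((d : ℝ) + 1) * (Bf * epsCoupling P U 1) := by
    intro j hjd
    unfold epsCoupling; rw [abs_of_pos hU]
    have hj' : (j : ℝ) ≤ d := Nat.cast_le.2 hjd
    have h1 : P.Klam * (U + U ^ 2 * (j : ℝ)) ≤ P.Klam * (U + U ^ 2 * (d : ℝ)) := by gcongr
    have h2 : P.Klam * (U + U ^ 2 * (d : ℝ)) + P.Klam * ((d : ℝ) * U + U ^ 2) = ((d : ℝ) + 1) * (P.Klam * (U + U ^ 2 * ((1 : ℕ) : ℝ))) := by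
      push_cast; ring
    have h3 : 0 ≤ P.Klam * ((d : ℝ) * U + U ^ 2) := by positivity
    have h4 : Bf * (P.Klam * (U + U ^ 2 * (j : ℝ))) ≤ Bf * (((d : ℝ) + 1) * (P.Klam * (U + U ^ 2 * ((1 : ℕ) : ℝ)))) :=
      mul_le_mul_of_nonneg_left (by linarith) hBf0.le
    linarith
  exact ⟨hl0, hlam, hlamd, hlow, hεle, mul_pos hBf0 hε1⟩

end Summit.HubbardSuperconductivity.HubbardSuperconductivity.Theorems.EngineV8

end
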